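import Literature.NumberTheory.Automorphic.GL2CESHCochainAlgebra
import Literature.NumberTheory.Automorphic.Sl2SymPowerShiftOps
import HarnessLib

/-!
# The coordinate model `H = C ⊗ (Sym^d ⊗ Sym^d‾)` of the Eichler–Shimura–Harder complex for `GL₂(ℂ)`

For a real `𝔤𝔩₂(ℂ)`-module `C` (six lawful operators `O`, `GL2CKType.Ops`) and `d : ℕ`, the module
`H` of `C`-valued arrays `u : ℕ → ℕ → C` supported on `{0,…,d}²` (`model C d`, the coordinates of
`C ⊗ V'`, `V' = Sym^d ⊗ \overline{Sym^d}` in the weight bases) carries two COMMUTING lawful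
families: `opsAut O d` (the automorphic factor, `O` applied to the values) and `opsCoeff C d` (the
coefficient factor: the weight-coordinate `𝔰𝔩₂`-triples of `Sl2SymPowerShiftOps`, `L` on the outer
and `R` on the inner index), with `Ω_L = Ω_R = ½ d(d+2)` on the coefficient factor
(`casL_opsCoeff`, `casR_opsCoeff`).  This is the input format of `GL2CESHCochainAlgebra`
(`setup`, `eshCochain_closed_coclosed`).  Also proved here, for lawful `O`:

* the string identity `E_k F_k^{m+1} v = (m+1)(b−m) F_k^m v` of a highest-weight vector
  (`Ek_Fk_pow_succ`) and **`F_k^{n+1} v = 0`** for a highest-weight vector of natural weight `n`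
  lying in a finite-dimensional `𝔨`-stable subspace (`Fk_pow_succ_eq_zero`, Mathlib's
  finite-dimensional `𝔰𝔩₂`-theory) [cite: FultonHarrisGTM129, §11.1];
* the elementary tensors `tens w u` (`(l, m) ↦ u l m • w`) and their equivariance.

No named fact.
-/

noncomputable section

open Finset Complex
open scoped BigOperators ComplexConjugate

-- Mathlib idiom (Mathlib/Algebra/Lie/OfAssociative.lean): `Module.End ℂ S` as a Lie algebra acting on `S`, to invoke
-- Mathlib's `IsSl2Triple` theory (as in `GL2CUnitaryKTypes`).
attribute [local instance 100] LieRing.ofAssociativeRing LieAlgebra.ofAssociativeAlgebra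
  LieModule.ofAssociativeModule

namespace Literature.NumberTheory.Automorphic

namespace GL2CKType

namespace Ops

variable {M : Type*} [AddCommGroup M] [Module ℂ M] {O : Ops M} (hO : O.IsLawful)
include hO

/-! ### Strings of a highest-weight vector -/

/-- `H_k F_k^m v = (b − 2m) F_k^m v` for `H_k v = b v`. [cite: FultonHarrisGTM129, §11.1] -/
theorem Hk_Fk_pow {v : M} {b : ℂ} (hv : O.Hk v = b • v) (m : ℕ) :
    O.Hk ((O.Fk ^ m) v) = (b - 2 * m) • (O.Fk ^ m) v := by
  induction m with
  | zero => simpa using hv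
  | succ m ih =>
    rw [pow_succ', Module.End.mul_apply, Hk_Fk hO, ih, map_smul, ← sub_smul]
    congr 1; push_cast; ring

/-- **`E_k F_k^{m+1} v = (m+1)(b − m) F_k^m v`** for a highest-weight vector `v` of weight `b`.
[cite: FultonHarrisGTM129, §11.1 (11.6)] -/
theorem Ek_Fk_pow_succ {v : M} {b : ℂ} (hw : O.IsHW v b) (m : ℕ) :
    O.Ek ((O.Fk ^ (m + 1)) v) = ((m + 1 : ℂ) * (b - m)) • (O.Fk ^ m) v := by
  induction m with
  | zero =>
    rw [zero_add, pow_one, pow_zero, Module.End.one_apply, Ek_Fk hO, hw.ek, map_zero, zero_add,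
      hw.hk]
    congr 1; push_cast; ring
  | succ m ih =>
    rw [pow_succ', Module.End.mul_apply, Ek_Fk hO, ih, map_smul, Hk_Fk_pow hO hw.hk (m + 1),
      ← Module.End.mul_apply (f := O.Fk), ← pow_succ', ← add_smul]
    congr 1; push_cast; ring

omit hO in
/-- Iterates of `F_k` stay in an `F_k`-stable subspace. [folklore] -/
theorem Fk_pow_mem {S : Submodule ℂ M} (hFS : ∀ x ∈ S, O.Fk x ∈ S) {v : M} (hv : v ∈ S) (m : ℕ) :
    (O.Fk ^ m) v ∈ S := by
  induction m with
  | zero => simpa using hv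
  | succ m ih => rw [pow_succ', Module.End.mul_apply]; exact hFS _ ih

/-- **`F_k^{n+1} v = 0` for a highest-weight vector of natural weight `n` in a finite-dimensional
`𝔨`-stable subspace** (the finite-dimensional `𝔰𝔩₂`-module generated by `v` is `V_n`; Mathlib's
`IsSl2Triple.HasPrimitiveVectorWith.pow_toEnd_f_eq_zero_of_eq_nat`). [cite: FultonHarrisGTM129, §11.1] -/
theorem Fk_pow_succ_eq_zero {S : Submodule ℂ M} [FiniteDimensional ℂ S]
    (hES : ∀ x ∈ S, O.Ek x ∈ S) (hFS : ∀ x ∈ S, O.Fk x ∈ S) (hHS : ∀ x ∈ S, O.Hk x ∈ S)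
    {v : M} (hvS : v ∈ S) {n : ℕ} (hw : O.IsHW v (n : ℂ)) : (O.Fk ^ (n + 1)) v = 0 := by
  by_cases hv0 : v = 0
  · subst hv0; simp
  set e : Module.End ℂ S := (O.Ek).restrict hES with he
  set f : Module.End ℂ S := (O.Fk).restrict hFS with hf
  set h : Module.End ℂ S := (O.Hk).restrict hHS with hh
  by_cases hh0 : h = 0
  · -- `H_k = 0` on `S` forces `F_k = 0` on `S`
    have hH0 : ∀ x ∈ S, O.Hk x = 0 := fun x hx => by
      have := congrArg (fun T : Module.End ℂ S => ((T ⟨x, hx⟩ : S) : M)) hh0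
      simpa [hh] using this
    have hF0 : ∀ x ∈ S, O.Fk x = 0 := fun x hx => by
      have h1 := Hk_Fk hO x
      rw [hH0 x hx, map_zero, hH0 _ (hFS x hx), zero_sub] at h1
      exact (smul_eq_zero.1 (neg_eq_zero.1 h1.symm)).resolve_left two_ne_zero
    rw [pow_succ, Module.End.mul_apply, hF0 v hvS, map_zero]
  · have t : IsSl2Triple h e f := by
      refine ⟨hh0, ?_, ?_, ?_⟩
      · refine LinearMap.ext fun x => Subtype.ext ?_
        show O.Ek (O.Fk (x : M)) - O.Fk (O.Ek (x : M)) = O.Hk (x : M)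
        rw [Ek_Fk hO]; abel
      · refine LinearMap.ext fun x => Subtype.ext ?_
        show O.Hk (O.Ek (x : M)) - O.Ek (O.Hk (x : M)) = 2 • O.Ek (x : M)
        rw [Hk_Ek hO, two_smul, two_nsmul]; abel
      · refine LinearMap.ext fun x => Subtype.ext ?_
        show O.Hk (O.Fk (x : M)) - O.Fk (O.Hk (x : M)) = -(2 • O.Fk (x : M))
        rw [Hk_Fk hO, two_smul, two_nsmul]; abel
    have hP : t.HasPrimitiveVectorWith (⟨v, hvS⟩ : S) (n : ℂ) :=
      { ne_zero := fun h0 => hv0 (congrArg Subtype.val h0)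
        lie_h := Subtype.ext hw.hk
        lie_e := Subtype.ext hw.ek }
    have hf0 := hP.pow_toEnd_f_eq_zero_of_eq_nat (n := n) rfl
    rw [LieModule.toEnd_module_end, LieHom.id_apply] at hf0
    have := congrArg Subtype.val hf0
    -- `(f ^ (n+1)) ⟨v, _⟩ = ⟨(F_k ^ (n+1)) v, _⟩`
    have hpow : ∀ m : ℕ, ((f ^ m) ⟨v, hvS⟩ : M) = (O.Fk ^ m) v := by
      intro m
      induction m with
      | zero => rfl
      | succ m ih => rw [pow_succ', Module.End.mul_apply, pow_succ', Module.End.mul_apply, ← ih]; rfl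
    rw [hpow] at this
    exact this

/-- **`F_k^i v ≠ 0` for `i ≤ n`** for a non-zero highest-weight vector of natural weight `n` in a
`𝔨`-stable subspace (Mathlib's `pow_toEnd_f_ne_zero_of_eq_nat`). [cite: FultonHarrisGTM129, §11.1] -/
theorem Fk_pow_ne_zero {S : Submodule ℂ M}
    (hES : ∀ x ∈ S, O.Ek x ∈ S) (hFS : ∀ x ∈ S, O.Fk x ∈ S) (hHS : ∀ x ∈ S, O.Hk x ∈ S)
    {v : M} (hvS : v ∈ S) (hv0 : v ≠ 0) {n : ℕ} (hw : O.IsHW v (n : ℂ)) {i : ℕ} (hi : i ≤ n) :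
    (O.Fk ^ i) v ≠ 0 := by
  set e : Module.End ℂ S := (O.Ek).restrict hES with he
  set f : Module.End ℂ S := (O.Fk).restrict hFS with hf
  set h : Module.End ℂ S := (O.Hk).restrict hHS with hh
  by_cases hh0 : h = 0
  · -- then `H_k v = 0 = n • v`, so `n = 0`, `i = 0`
    have hH0 : O.Hk v = 0 := by
      have := congrArg (fun T : Module.End ℂ S => ((T ⟨v, hvS⟩ : S) : M)) hh0
      simpa [hh] using this
    have hn : (n : ℂ) = 0 := by
      have h1 := hw.hk
      rw [hH0] at h1
      exact ((smul_eq_zero.1 h1.symm).resolve_right hv0)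
    have hn0 : n = 0 := by exact_mod_cast hn
    have hi0 : i = 0 := by omega
    subst hi0
    simpa using hv0
  · have t : IsSl2Triple h e f := by
      refine ⟨hh0, ?_, ?_, ?_⟩
      · refine LinearMap.ext fun x => Subtype.ext ?_
        show O.Ek (O.Fk (x : M)) - O.Fk (O.Ek (x : M)) = O.Hk (x : M)
        rw [Ek_Fk hO]; abel
      · refine LinearMap.ext fun x => Subtype.ext ?_
        show O.Hk (O.Ek (x : M)) - O.Ek (O.Hk (x : M)) = 2 • O.Ek (x : M)
        rw [Hk_Ek hO, two_smul, two_nsmul]; abel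
      · refine LinearMap.ext fun x => Subtype.ext ?_
        show O.Hk (O.Fk (x : M)) - O.Fk (O.Hk (x : M)) = -(2 • O.Fk (x : M))
        rw [Hk_Fk hO, two_smul, two_nsmul]; abel
    have hP : t.HasPrimitiveVectorWith (⟨v, hvS⟩ : S) (n : ℂ) :=
      { ne_zero := fun h0 => hv0 (congrArg Subtype.val h0)
        lie_h := Subtype.ext hw.hk
        lie_e := Subtype.ext hw.ek }
    have hf0 := hP.pow_toEnd_f_ne_zero_of_eq_nat (n := n) rfl hi
    rw [LieModule.toEnd_module_end, LieHom.id_apply] at hf0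
    have hpow : ∀ m : ℕ, ((f ^ m) ⟨v, hvS⟩ : M) = (O.Fk ^ m) v := by
      intro m
      induction m with
      | zero => rfl
      | succ m ih => rw [pow_succ', Module.End.mul_apply, pow_succ', Module.End.mul_apply, ← ih]; rfl
    intro h0
    exact hf0 (Subtype.ext ((hpow i).trans h0))

end Ops

/-! ### Restriction of a family to a stable submodule -/

namespace Ops

variable {M : Type*} [AddCommGroup M] [Module ℂ M]

/-- All six operators preserve the submodule `p`. [folklore] -/
structure Preserves (O : Ops M) (p : Submodule ℂ M) : Prop where
  le : ∀ x ∈ p, O.LE x ∈ p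
  lf : ∀ x ∈ p, O.LF x ∈ p
  lh : ∀ x ∈ p, O.LH x ∈ p
  re : ∀ x ∈ p, O.RE x ∈ p
  rf : ∀ x ∈ p, O.RF x ∈ p
  rh : ∀ x ∈ p, O.RH x ∈ p

/-- The restricted family on a stable submodule. [folklore] -/
def restrict (O : Ops M) {p : Submodule ℂ M} (h : O.Preserves p) : Ops p where
  LE := O.LE.restrict h.le
  LF := O.LF.restrict h.lf
  LH := O.LH.restrict h.lh
  RE := O.RE.restrict h.re
  RF := O.RF.restrict h.rf
  RH := O.RH.restrict h.rh

variable {O : Ops M} {p : Submodule ℂ M} (h : O.Preserves p)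

/-- Unfolding. [folklore] -/
@[simp] theorem restrict_LE (x : p) : ((O.restrict h).LE x : M) = O.LE x := rfl
/-- Unfolding. [folklore] -/
@[simp] theorem restrict_LF (x : p) : ((O.restrict h).LF x : M) = O.LF x := rfl
/-- Unfolding. [folklore] -/
@[simp] theorem restrict_LH (x : p) : ((O.restrict h).LH x : M) = O.LH x := rfl
/-- Unfolding. [folklore] -/
@[simp] theorem restrict_RE (x : p) : ((O.restrict h).RE x : M) = O.RE x := rfl
/-- Unfolding. [folklore] -/
@[simp] theorem restrict_RF (x : p) : ((O.restrict h).RF x : M) = O.RF x := rfl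
/-- Unfolding. [folklore] -/
@[simp] theorem restrict_RH (x : p) : ((O.restrict h).RH x : M) = O.RH x := rfl
/-- Unfolding. [folklore] -/
@[simp] theorem restrict_Ek (x : p) : ((O.restrict h).Ek x : M) = O.Ek x := rfl
/-- Unfolding. [folklore] -/
@[simp] theorem restrict_Fk (x : p) : ((O.restrict h).Fk x : M) = O.Fk x := rfl
/-- Unfolding. [folklore] -/
@[simp] theorem restrict_Hk (x : p) : ((O.restrict h).Hk x : M) = O.Hk x := rfl
/-- Unfolding. [folklore] -/
@[simp] theorem restrict_casL (x : p) : ((O.restrict h).casL x : M) = O.casL x := rfl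
/-- Unfolding. [folklore] -/
@[simp] theorem restrict_casR (x : p) : ((O.restrict h).casR x : M) = O.casR x := rfl

/-- **The restricted family is lawful if the fifteen relations hold on `p`.** [folklore] -/
theorem isLawful_restrict
    (lhe : ∀ v ∈ p, O.LH (O.LE v) = O.LE (O.LH v) + (2 : ℂ) • O.LE v)
    (lhf : ∀ v ∈ p, O.LH (O.LF v) = O.LF (O.LH v) - (2 : ℂ) • O.LF v)
    (lef : ∀ v ∈ p, O.LE (O.LF v) = O.LF (O.LE v) + O.LH v)
    (rhe : ∀ v ∈ p, O.RH (O.RE v) = O.RE (O.RH v) + (2 : ℂ) • O.RE v)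
    (rhf : ∀ v ∈ p, O.RH (O.RF v) = O.RF (O.RH v) - (2 : ℂ) • O.RF v)
    (ref : ∀ v ∈ p, O.RE (O.RF v) = O.RF (O.RE v) + O.RH v)
    (cEE : ∀ v ∈ p, O.RE (O.LE v) = O.LE (O.RE v)) (cEF : ∀ v ∈ p, O.RE (O.LF v) = O.LF (O.RE v))
    (cEH : ∀ v ∈ p, O.RE (O.LH v) = O.LH (O.RE v)) (cFE : ∀ v ∈ p, O.RF (O.LE v) = O.LE (O.RF v))
    (cFF : ∀ v ∈ p, O.RF (O.LF v) = O.LF (O.RF v)) (cFH : ∀ v ∈ p, O.RF (O.LH v) = O.LH (O.RF v))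
    (cHE : ∀ v ∈ p, O.RH (O.LE v) = O.LE (O.RH v)) (cHF : ∀ v ∈ p, O.RH (O.LF v) = O.LF (O.RH v))
    (cHH : ∀ v ∈ p, O.RH (O.LH v) = O.LH (O.RH v)) : (O.restrict h).IsLawful where
  lhe v := Subtype.ext (lhe v v.2)
  lhf v := Subtype.ext (lhf v v.2)
  lef v := Subtype.ext (lef v v.2)
  rhe v := Subtype.ext (rhe v v.2)
  rhf v := Subtype.ext (rhf v v.2)
  ref v := Subtype.ext (ref v v.2)
  cEE v := Subtype.ext (cEE v v.2)
  cEF v := Subtype.ext (cEF v v.2)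
  cEH v := Subtype.ext (cEH v v.2)
  cFE v := Subtype.ext (cFE v v.2)
  cFF v := Subtype.ext (cFF v v.2)
  cFH v := Subtype.ext (cFH v v.2)
  cHE v := Subtype.ext (cHE v v.2)
  cHF v := Subtype.ext (cHF v v.2)
  cHH v := Subtype.ext (cHH v v.2)

/-- A family lawful on the whole space restricts to a lawful family. [folklore] -/
theorem IsLawful.restrict (hO : O.IsLawful) : (O.restrict h).IsLawful :=
  isLawful_restrict h (fun v _ => hO.lhe v) (fun v _ => hO.lhf v) (fun v _ => hO.lef v)
    (fun v _ => hO.rhe v) (fun v _ => hO.rhf v) (fun v _ => hO.ref v) (fun v _ => hO.cEE v)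
    (fun v _ => hO.cEF v) (fun v _ => hO.cEH v) (fun v _ => hO.cFE v) (fun v _ => hO.cFF v)
    (fun v _ => hO.cFH v) (fun v _ => hO.cHE v) (fun v _ => hO.cHF v) (fun v _ => hO.cHH v)

/-- Commutation passes to restrictions. [folklore] -/
theorem CommutesWith.restrict {O₁ O₂ : Ops M} (h₁ : O₁.Preserves p) (h₂ : O₂.Preserves p)
    (hc : O₁.CommutesWith O₂) : (O₁.restrict h₁).CommutesWith (O₂.restrict h₂) := by
  intro A hA B hB v
  simp only [toList, List.mem_cons, List.not_mem_nil, or_false] at hA hB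
  apply Subtype.ext
  have hc' : ∀ A', (A' = O₁.LE ∨ A' = O₁.LF ∨ A' = O₁.LH ∨ A' = O₁.RE ∨ A' = O₁.RF ∨ A' = O₁.RH) →
      ∀ B', (B' = O₂.LE ∨ B' = O₂.LF ∨ B' = O₂.LH ∨ B' = O₂.RE ∨ B' = O₂.RF ∨ B' = O₂.RH) →
      ∀ v : M, A' (B' v) = B' (A' v) := fun A' hA' B' hB' =>
    hc A' ((mem_toList O₁ A').2 hA') B' ((mem_toList O₂ B').2 hB')
  rcases hA with rfl | rfl | rfl | rfl | rfl | rfl <;> rcases hB with rfl | rfl | rfl | rfl | rfl | rfl <;>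
  first
  | exact hc' O₁.LE (by simp) _ (by simp) _ | exact hc' O₁.LF (by simp) _ (by simp) _
  | exact hc' O₁.LH (by simp) _ (by simp) _ | exact hc' O₁.RE (by simp) _ (by simp) _
  | exact hc' O₁.RF (by simp) _ (by simp) _ | exact hc' O₁.RH (by simp) _ (by simp) _

end Ops

end GL2CKType

/-! ### The coordinate model -/

namespace GL2CESH

open GL2CKType Sl2Coord

variable {C : Type*} [AddCommGroup C] [Module ℂ C]

/-- `T` applied to the values of an array. [folklore] -/
def onVal (T : Module.End ℂ C) : Module.End ℂ (ℕ → ℕ → C) where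
  toFun u l m := T (u l m)
  map_add' u v := by funext l m; simp
  map_smul' c u := by funext l m; simp

/-- Unfolding. [folklore] -/
@[simp] theorem onVal_apply (T : Module.End ℂ C) (u : ℕ → ℕ → C) (l m : ℕ) :
    onVal T u l m = T (u l m) := rfl

/-- An operator on `ℕ → C` applied to every row `u l` (the inner index). [folklore] -/
def onInner (S : Module.End ℂ (ℕ → C)) : Module.End ℂ (ℕ → ℕ → C) where
  toFun u l := S (u l)
  map_add' u v := by funext l; simp
  map_smul' c u := by funext l; simp

/-- Unfolding. [folklore] -/
@[simp] theorem onInner_apply (S : Module.End ℂ (ℕ → C)) (u : ℕ → ℕ → C) (l : ℕ) :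
    onInner S u l = S (u l) := rfl

variable (C) in
/-- **The automorphic family** on arrays: the six operators of `C` applied to the values
(`O ⊗ 1` on `C ⊗ V'`). [folklore] -/
def opsAut (O : Ops C) : Ops (ℕ → ℕ → C) where
  LE := onVal O.LE
  LF := onVal O.LF
  LH := onVal O.LH
  RE := onVal O.RE
  RF := onVal O.RF
  RH := onVal O.RH

variable (C) in
/-- **The coefficient family** on arrays (`1 ⊗ O_{V'}` on `C ⊗ V'`, `V' = Sym^d ⊗ \overline{Sym^d}`):
`L(E), L(F), L(H)` the weight-coordinate triple on the OUTER index, `R(E), R(F), R(H)` on the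
INNER index. [cite: FultonHarrisGTM129, §11.1] -/
def opsCoeff (d : ℕ) : Ops (ℕ → ℕ → C) where
  LE := sE d
  LF := sF
  LH := sH d
  RE := onInner (sE d)
  RF := onInner sF
  RH := onInner (sH d)

section Unfold

variable (O : Ops C) (d : ℕ) (u : ℕ → ℕ → C) (l m : ℕ)

/-- Unfolding. [folklore] -/
@[simp] theorem opsAut_LE : (opsAut C O).LE u l m = O.LE (u l m) := rfl
/-- Unfolding. [folklore] -/
@[simp] theorem opsAut_LF : (opsAut C O).LF u l m = O.LF (u l m) := rfl
/-- Unfolding. [folklore] -/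
@[simp] theorem opsAut_LH : (opsAut C O).LH u l m = O.LH (u l m) := rfl
/-- Unfolding. [folklore] -/
@[simp] theorem opsAut_RE : (opsAut C O).RE u l m = O.RE (u l m) := rfl
/-- Unfolding. [folklore] -/
@[simp] theorem opsAut_RF : (opsAut C O).RF u l m = O.RF (u l m) := rfl
/-- Unfolding. [folklore] -/
@[simp] theorem opsAut_RH : (opsAut C O).RH u l m = O.RH (u l m) := rfl
/-- Unfolding: `L(E)` is the outer `E`. [folklore] -/
theorem opsCoeff_LE : (opsCoeff C d).LE u = sE d u := rfl
/-- Unfolding. [folklore] -/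
theorem opsCoeff_LF : (opsCoeff C d).LF u = sF u := rfl
/-- Unfolding. [folklore] -/
theorem opsCoeff_LH : (opsCoeff C d).LH u = sH d u := rfl
/-- Unfolding: `R(E)` is the inner `E`. [folklore] -/
@[simp] theorem opsCoeff_RE : (opsCoeff C d).RE u l = sE d (u l) := rfl
/-- Unfolding. [folklore] -/
@[simp] theorem opsCoeff_RF : (opsCoeff C d).RF u l = sF (u l) := rfl
/-- Unfolding. [folklore] -/
@[simp] theorem opsCoeff_RH : (opsCoeff C d).RH u l = sH d (u l) := rfl

/-- The outer `E` read on an entry: `(E u) (l+1) m = (d − l) u l m`, `(E u) 0 m = 0`. [folklore] -/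
@[simp] theorem opsCoeff_LE_apply_succ : (opsCoeff C d).LE u (l + 1) m = ((d - l : ℕ) : ℂ) • u l m := by
  rw [opsCoeff_LE, sE_apply_succ]; rfl
/-- [folklore] -/
@[simp] theorem opsCoeff_LE_apply_zero : (opsCoeff C d).LE u 0 m = 0 := by
  rw [opsCoeff_LE, sE_apply_zero]; rfl
/-- The outer `F` read on an entry. [folklore] -/
@[simp] theorem opsCoeff_LF_apply : (opsCoeff C d).LF u l m = ((l + 1 : ℕ) : ℂ) • u (l + 1) m := by
  rw [opsCoeff_LF, sF_apply]; rfl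
/-- The outer `H` read on an entry. [folklore] -/
@[simp] theorem opsCoeff_LH_apply : (opsCoeff C d).LH u l m = ((2 * l : ℕ) - d : ℂ) • u l m := by
  rw [opsCoeff_LH, sH_apply]; rfl

end Unfold

/-! ### Lawfulness and commutation on the big space -/

section Big

variable {O : Ops C} (d : ℕ)

/-- The automorphic family is lawful when `O` is. [folklore] -/
theorem isLawful_opsAut (hO : O.IsLawful) : (opsAut C O).IsLawful := by
  refine ⟨?_, ?_, ?_, ?_, ?_, ?_, ?_, ?_, ?_, ?_, ?_, ?_, ?_, ?_, ?_⟩ <;> intro v <;> funext l m <;>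
  simp [hO.lhe, hO.lhf, hO.lef, hO.rhe, hO.rhf, hO.ref, hO.cEE, hO.cEF, hO.cEH, hO.cFE, hO.cFF,
    hO.cFH, hO.cHE, hO.cHF, hO.cHH]

/-- The automorphic and the coefficient families commute (one acts on values, the other on
indices). [folklore] -/
theorem commutesWith_opsAut_opsCoeff (O : Ops C) : (opsAut C O).CommutesWith (opsCoeff C d) := by
  intro A hA B hB v
  simp only [Ops.toList, List.mem_cons, List.not_mem_nil, or_false] at hA hB
  rcases hA with rfl | rfl | rfl | rfl | rfl | rfl <;> rcases hB with rfl | rfl | rfl | rfl | rfl | rfl <;>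
  funext l m <;> rcases l with _ | l <;> rcases m with _ | m <;> simp [sE_apply_zero, sE_apply_succ]

end Big

/-! ### The model: arrays supported on `{0,…,d}²` -/

variable (C) in
/-- **The model** `H ≅ C ⊗ Sym^d ⊗ \overline{Sym^d}`: arrays `ℕ → ℕ → C` supported on `{0,…,d}²`.
[folklore] -/
def model (d : ℕ) : Submodule ℂ (ℕ → ℕ → C) where
  carrier := {u | ∀ l m, (d < l ∨ d < m) → u l m = 0}
  zero_mem' := fun _ _ _ => rfl
  add_mem' hu hv l m h := by simp [hu l m h, hv l m h]
  smul_mem' c u hu l m h := by simp [hu l m h]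

/-- Membership. [folklore] -/
theorem mem_model {d : ℕ} {u : ℕ → ℕ → C} : u ∈ model C d ↔ ∀ l m, (d < l ∨ d < m) → u l m = 0 :=
  Iff.rfl

/-- A member of the model has outer support `≤ d` (as a vector of rows). [folklore] -/
theorem outer_mem_supp {d : ℕ} {u : ℕ → ℕ → C} (hu : u ∈ model C d) : u ∈ supp (ℕ → C) d :=
  fun l hl => funext fun m => hu l m (Or.inl hl)

/-- Every row of a member of the model has support `≤ d`. [folklore] -/
theorem row_mem_supp {d : ℕ} {u : ℕ → ℕ → C} (hu : u ∈ model C d) (l : ℕ) : u l ∈ supp C d :=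
  fun m hm => hu l m (Or.inr hm)

section Preserve

variable (O : Ops C) (d : ℕ)

/-- The automorphic family preserves the model. [folklore] -/
theorem preserves_opsAut : (opsAut C O).Preserves (model C d) := by
  refine ⟨?_, ?_, ?_, ?_, ?_, ?_⟩ <;> intro x hx l m h <;> simp [hx l m h]

/-- The coefficient family preserves the model. [folklore] -/
theorem preserves_opsCoeff : (opsCoeff C d).Preserves (model C d) := by
  refine ⟨?_, ?_, ?_, ?_, ?_, ?_⟩ <;> intro x hx l m h
  · rcases l with _ | l
    · simp
    · rw [opsCoeff_LE_apply_succ]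
      rcases h with h | h
      · rcases Nat.lt_or_ge d l with h' | h'
        · rw [hx l m (Or.inl h'), smul_zero]
        · have : d - l = 0 := by omega
          rw [this, Nat.cast_zero, zero_smul]
      · rw [hx l m (Or.inr h), smul_zero]
  · rw [opsCoeff_LF_apply, hx (l + 1) m (h.imp (fun h => by omega) id), smul_zero]
  · rw [opsCoeff_LH_apply, hx l m h, smul_zero]
  · show sE d (x l) m = 0
    rcases m with _ | m
    · simp
    · rw [sE_apply_succ]
      rcases h with h | h
      · rw [hx l m (Or.inl h), smul_zero]
      · rcases Nat.lt_or_ge d m with h' | h'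
        · rw [hx l m (Or.inr h'), smul_zero]
        · have : d - m = 0 := by omega
          rw [this, Nat.cast_zero, zero_smul]
  · show sF (x l) m = 0
    rw [sF_apply, hx l (m + 1) (h.imp id (fun h => by omega)), smul_zero]
  · show sH d (x l) m = 0
    rw [sH_apply, hx l m h, smul_zero]

/-- **The automorphic family of the model** (restriction). [folklore] -/
def aut : Ops (model C d) := (opsAut C O).restrict (preserves_opsAut O d)

/-- **The coefficient family of the model** (restriction). [folklore] -/
def coeff : Ops (model C d) := (opsCoeff C d).restrict (preserves_opsCoeff (C := C) d)

variable {O}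

/-- The automorphic family of the model is lawful. [folklore] -/
theorem isLawful_aut (hO : O.IsLawful) : (aut O d).IsLawful :=
  (isLawful_opsAut hO).restrict _

/-- **The coefficient family of the model is lawful** (the `[E, F] = H` relations need the support).
[cite: FultonHarrisGTM129, §11.1] -/
theorem isLawful_coeff : (coeff (C := C) d).IsLawful := by
  refine Ops.isLawful_restrict _ (fun v _ => sH_sE v) (fun v _ => sH_sF v)
    (fun v hv => sE_sF (outer_mem_supp hv)) (fun v _ => ?_) (fun v _ => ?_) (fun v hv => ?_)
    (fun v _ => ?_) (fun v _ => ?_) (fun v _ => ?_) (fun v _ => ?_) (fun v _ => ?_) (fun v _ => ?_)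
    (fun v _ => ?_) (fun v _ => ?_) (fun v _ => ?_)
  · funext l; exact sH_sE (v l)
  · funext l; exact sH_sF (v l)
  · funext l; exact sE_sF (row_mem_supp hv l)
  all_goals funext l m; rcases l with _ | l <;> rcases m with _ | m <;> simp [sE_apply_succ, smul_smul, mul_comm]

/-- The two families of the model commute. [folklore] -/
theorem commutesWith_aut_coeff : (aut O d).CommutesWith (coeff (C := C) d) :=
  Ops.CommutesWith.restrict _ _ (commutesWith_opsAut_opsCoeff d O)

/-- **`Ω_L = ½ d(d+2)` on the coefficient family.** [cite: FultonHarrisGTM129, §11.1] -/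
theorem casL_coeff (v : model C d) :
    (coeff (C := C) d).casL v = ((2 : ℂ)⁻¹ * (d * (d + 2))) • v := by
  apply Subtype.ext
  simp only [coeff, Ops.casL_apply, SetLike.val_smul]
  exact casimir_apply (outer_mem_supp v.2)

/-- **`Ω_R = ½ d(d+2)` on the coefficient family.** [cite: FultonHarrisGTM129, §11.1] -/
theorem casR_coeff (v : model C d) :
    (coeff (C := C) d).casR v = ((2 : ℂ)⁻¹ * (d * (d + 2))) • v := by
  apply Subtype.ext
  simp only [coeff, Ops.casR_apply, SetLike.val_smul]
  funext l
  have := casimir_apply (row_mem_supp v.2 l)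
  simpa using this

/-- The Casimirs of the automorphic family are those of `O` on the values. [folklore] -/
theorem casL_aut {c : ℂ} (hcL : ∀ x, O.casL x = c • x) (v : model C d) : (aut O d).casL v = c • v := by
  apply Subtype.ext; funext l m
  show O.casL (v.1 l m) = c • v.1 l m
  exact hcL _

/-- [folklore] -/
theorem casR_aut {c : ℂ} (hcR : ∀ x, O.casR x = c • x) (v : model C d) : (aut O d).casR v = c • v := by
  apply Subtype.ext; funext l m
  show O.casR (v.1 l m) = c • v.1 l m
  exact hcR _

end Preserve

/-! ### Elementary tensors -/

section Tens

variable (d : ℕ)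

/-- The elementary tensor `w ⊗ u`: the array `(l, m) ↦ u l m • w` for a scalar array `u`.
[folklore] -/
def tens (w : C) (u : model ℂ d) : model C d :=
  ⟨fun l m => (u : ℕ → ℕ → ℂ) l m • w, fun l m h => by
    show (u : ℕ → ℕ → ℂ) l m • w = 0
    rw [u.2 l m h, zero_smul]⟩

/-- Unfolding. [folklore] -/
@[simp] theorem tens_apply (w : C) (u : model ℂ d) (l m : ℕ) :
    (tens d w u : ℕ → ℕ → C) l m = (u : ℕ → ℕ → ℂ) l m • w := rfl

/-- `tens` is additive in the scalar array. [folklore] -/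
theorem tens_add (w : C) (u u' : model ℂ d) : tens d w (u + u') = tens d w u + tens d w u' := by
  apply Subtype.ext; funext l m; simp [add_smul]

/-- `tens` is homogeneous in the scalar array. [folklore] -/
theorem tens_smul (w : C) (c : ℂ) (u : model ℂ d) : tens d w (c • u) = c • tens d w u := by
  apply Subtype.ext; funext l m; simp [smul_smul]

/-- `tens` respects differences in the scalar array. [folklore] -/
theorem tens_sub (w : C) (u u' : model ℂ d) : tens d w (u - u') = tens d w u - tens d w u' := by
  apply Subtype.ext; funext l m; simp [sub_smul]

/-- `tens` is additive in the vector. [folklore] -/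
theorem tens_add_left (w w' : C) (u : model ℂ d) : tens d (w + w') u = tens d w u + tens d w' u := by
  apply Subtype.ext; funext l m; simp [smul_add]

/-- `tens` is homogeneous in the vector. [folklore] -/
theorem tens_smul_left (c : ℂ) (w : C) (u : model ℂ d) : tens d (c • w) u = c • tens d w u := by
  apply Subtype.ext; funext l m; simp [smul_comm c]

variable (O : Ops C)

/-- **The automorphic family acts on the first factor**: `X₁ (w ⊗ u) = (X w) ⊗ u`. [folklore] -/
theorem aut_tens (w : C) (u : model ℂ d) :
    (aut O d).LE (tens d w u) = tens d (O.LE w) u ∧ (aut O d).LF (tens d w u) = tens d (O.LF w) u ∧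
    (aut O d).LH (tens d w u) = tens d (O.LH w) u ∧ (aut O d).RE (tens d w u) = tens d (O.RE w) u ∧
    (aut O d).RF (tens d w u) = tens d (O.RF w) u ∧ (aut O d).RH (tens d w u) = tens d (O.RH w) u := by
  refine ⟨?_, ?_, ?_, ?_, ?_, ?_⟩ <;> (apply Subtype.ext; funext l m; simp [aut])

/-- **The coefficient family acts on the second factor**: `X₂ (w ⊗ u) = w ⊗ (X u)`. [folklore] -/
theorem coeff_tens (w : C) (u : model ℂ d) :
    (coeff (C := C) d).LE (tens d w u) = tens d w ((coeff (C := ℂ) d).LE u) ∧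
    (coeff (C := C) d).LF (tens d w u) = tens d w ((coeff (C := ℂ) d).LF u) ∧
    (coeff (C := C) d).LH (tens d w u) = tens d w ((coeff (C := ℂ) d).LH u) ∧
    (coeff (C := C) d).RE (tens d w u) = tens d w ((coeff (C := ℂ) d).RE u) ∧
    (coeff (C := C) d).RF (tens d w u) = tens d w ((coeff (C := ℂ) d).RF u) ∧
    (coeff (C := C) d).RH (tens d w u) = tens d w ((coeff (C := ℂ) d).RH u) := by
  refine ⟨?_, ?_, ?_, ?_, ?_, ?_⟩ <;>
  (apply Subtype.ext; funext l m; rcases l with _ | l <;> rcases m with _ | m <;>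
    simp [coeff, sE_apply_succ, smul_smul])

/-- `E_k, F_k, H_k` of the automorphic family on tensors. [folklore] -/
theorem aut_k_tens (w : C) (u : model ℂ d) :
    (aut O d).Ek (tens d w u) = tens d (O.Ek w) u ∧ (aut O d).Fk (tens d w u) = tens d (O.Fk w) u ∧
    (aut O d).Hk (tens d w u) = tens d (O.Hk w) u := by
  obtain ⟨h1, h2, h3, h4, h5, h6⟩ := aut_tens d O w u
  refine ⟨?_, ?_, ?_⟩
  · rw [Ops.Ek_apply, Ops.Ek_apply, h1, h5, ← Subtype.coe_inj]; simp
    funext l m; simp [smul_sub]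
  · rw [Ops.Fk_apply, Ops.Fk_apply, h2, h4, ← Subtype.coe_inj]; simp
    funext l m; simp [smul_sub]
  · rw [Ops.Hk_apply, Ops.Hk_apply, h3, h6, ← Subtype.coe_inj]; simp
    funext l m; simp [smul_sub]

/-- `E_k, F_k, H_k` of the coefficient family on tensors. [folklore] -/
theorem coeff_k_tens (w : C) (u : model ℂ d) :
    (coeff (C := C) d).Ek (tens d w u) = tens d w ((coeff (C := ℂ) d).Ek u) ∧
    (coeff (C := C) d).Fk (tens d w u) = tens d w ((coeff (C := ℂ) d).Fk u) ∧
    (coeff (C := C) d).Hk (tens d w u) = tens d w ((coeff (C := ℂ) d).Hk u) := by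
  obtain ⟨h1, h2, h3, h4, h5, h6⟩ := coeff_tens d w u
  refine ⟨?_, ?_, ?_⟩
  · rw [Ops.Ek_apply, Ops.Ek_apply, h1, h5, ← tens_sub]
  · rw [Ops.Fk_apply, Ops.Fk_apply, h2, h4, ← tens_sub]
  · rw [Ops.Hk_apply, Ops.Hk_apply, h3, h6, ← tens_sub]

/-- Iterates of `F_k` of the coefficient family on tensors. [folklore] -/
theorem coeff_Fk_pow_tens (w : C) (u : model ℂ d) (j : ℕ) :
    ((coeff (C := C) d).Fk ^ j) (tens d w u) = tens d w (((coeff (C := ℂ) d).Fk ^ j) u) := by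
  induction j with
  | zero => simp
  | succ j ih => rw [pow_succ', Module.End.mul_apply, ih, (coeff_k_tens d w _).2.1, pow_succ',
      Module.End.mul_apply]

/-- Iterates of `F_k` of the automorphic family on tensors. [folklore] -/
theorem aut_Fk_pow_tens (w : C) (u : model ℂ d) (j : ℕ) :
    ((aut O d).Fk ^ j) (tens d w u) = tens d ((O.Fk ^ j) w) u := by
  induction j with
  | zero => simp
  | succ j ih => rw [pow_succ', Module.End.mul_apply, ih, (aut_k_tens d O _ u).2.1, pow_succ',
      Module.End.mul_apply]

/-- The entry `(d, 0)` of an elementary tensor. [folklore] -/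
theorem tens_ne_zero {w : C} (hw : w ≠ 0) {u : model ℂ d} (hu : (u : ℕ → ℕ → ℂ) d 0 ≠ 0) :
    tens d w u ≠ 0 := fun h => by
  have := congrArg (fun x : model C d => (x : ℕ → ℕ → C) d 0) h
  simp only [tens_apply, ZeroMemClass.coe_zero, Pi.zero_apply, smul_eq_zero] at this
  exact this.elim hu hw

end Tens

/-! ### The top vector of the coefficients and its weight -/

section Top

variable (d : ℕ)

/-- The `𝔨`-highest-weight vector `x^d ⊗ ȳ^d` of `V' = Sym^d ⊗ \overline{Sym^d}` (outer index `d`,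
inner index `0`): weight `2d` for `H_k = L(H) − R(H)`. [cite: Harder1987, §3.1] -/
def vTop : model ℂ d :=
  ⟨Pi.single d (Pi.single 0 1), fun l m h => by
    rcases h with h | h
    · rw [Pi.single_eq_of_ne (by omega)]; rfl
    · by_cases hl : l = d
      · subst hl; rw [Pi.single_eq_same, Pi.single_eq_of_ne (by omega)]
      · rw [Pi.single_eq_of_ne hl]; rfl⟩

/-- The entry `(d, 0)` of `vTop` is `1`. [folklore] -/
@[simp] theorem vTop_apply_top : (vTop d : ℕ → ℕ → ℂ) d 0 = 1 := by simp [vTop]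

/-- **`E_k vTop = 0`**. [folklore] -/
theorem coeff_Ek_vTop : (coeff (C := ℂ) d).Ek (vTop d) = 0 := by
  apply Subtype.ext
  change sE d (Pi.single d (Pi.single 0 (1 : ℂ))) - (fun l => sF ((Pi.single d (Pi.single 0 (1 : ℂ)) : ℕ → ℕ → ℂ) l)) = 0
  rw [sE_single_top]
  funext l
  by_cases hl : l = d
  · subst hl; simp [sF_single_zero]
  · simp [Pi.single_eq_of_ne hl]

/-- **`H_k vTop = 2d • vTop`**. [folklore] -/
theorem coeff_Hk_vTop : (coeff (C := ℂ) d).Hk (vTop d) = ((2 * d : ℕ) : ℂ) • vTop d := by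
  apply Subtype.ext
  change sH d (Pi.single d (Pi.single 0 (1 : ℂ))) - (fun l => sH d ((Pi.single d (Pi.single 0 (1 : ℂ)) : ℕ → ℕ → ℂ) l)) =
    ((2 * d : ℕ) : ℂ) • (Pi.single d (Pi.single 0 (1 : ℂ)) : ℕ → ℕ → ℂ)
  rw [sH_single]
  funext l m
  by_cases hl : l = d
  · subst hl
    simp only [Pi.sub_apply, Pi.smul_apply, Pi.single_eq_same, sH_single]
    rw [← sub_smul]; congr 1; push_cast; ring
  · simp [Pi.single_eq_of_ne hl]

/-- `vTop` is a `𝔨`-highest-weight vector of weight `2d`. [folklore] -/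
theorem isHW_vTop : (coeff (C := ℂ) d).IsHW (vTop d) ((2 * d : ℕ) : ℂ) :=
  ⟨coeff_Ek_vTop d, coeff_Hk_vTop d⟩

/-- The `(d, 0)` entry detects the weight `2d`: `(H_k x)_{d,0} = 2d · x_{d,0}`. [folklore] -/
theorem coeff_Hk_apply_top (x : model ℂ d) :
    ((coeff (C := ℂ) d).Hk x : ℕ → ℕ → ℂ) d 0 = ((2 * d : ℕ) : ℂ) * (x : ℕ → ℕ → ℂ) d 0 := by
  change (sH d (x : ℕ → ℕ → ℂ) - fun l => sH d ((x : ℕ → ℕ → ℂ) l)) d 0 = _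
  simp only [Pi.sub_apply, sH_apply, Pi.smul_apply, smul_eq_mul, Nat.cast_mul, Nat.cast_ofNat,
    mul_zero, Nat.cast_zero, zero_sub]
  ring

/-- **The top entry of the lowered vectors vanishes**: `(F_k^{m+1} vTop)_{d,0} = 0`. [folklore] -/
theorem Fk_pow_succ_vTop_apply_top (m : ℕ) :
    ((((coeff (C := ℂ) d).Fk ^ (m + 1)) (vTop d) : model ℂ d) : ℕ → ℕ → ℂ) d 0 = 0 := by
  set x := ((coeff (C := ℂ) d).Fk ^ (m + 1)) (vTop d)
  have h1 := Ops.Hk_Fk_pow (isLawful_coeff (C := ℂ) d) (coeff_Hk_vTop d) (m + 1)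
  have h2 := congrArg (fun z : model ℂ d => (z : ℕ → ℕ → ℂ) d 0) h1
  simp only [SetLike.val_smul, Pi.smul_apply, smul_eq_mul] at h2
  rw [coeff_Hk_apply_top] at h2
  -- `2d · x = (2d − 2(m+1)) · x` forces `x = 0`
  have h3 : (2 * (m + 1 : ℕ) : ℂ) * (x : ℕ → ℕ → ℂ) d 0 = 0 := by
    push_cast at h2 ⊢; linear_combination h2
  have hne : (2 * (m + 1 : ℕ) : ℂ) ≠ 0 := by
    rw [← Nat.cast_two, ← Nat.cast_mul, Nat.cast_ne_zero]; omega
  exact (mul_eq_zero.1 h3).resolve_left hne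

end Top

/-! ### The highest-weight vector `y` of weight `2` -/

section Y

variable (O : Ops C) (d : ℕ)

/-- The Clebsch–Gordan coefficients `c_j = (−1)^j ∏_{t<j} (k − t) · ∏_{j ≤ t < k} (k + 2 − t)`
(integers; `c_{j+1} (k + 2 − j) = −c_j (k − j)`), `k = 2d`. [cite: Harder1987, §3.1] -/
def cg (k j : ℕ) : ℂ :=
  (-1) ^ j * (∏ t ∈ range j, ((k : ℂ) - t)) * ∏ t ∈ Ico j k, ((k : ℂ) + 2 - t)

/-- **The recursion** `c_{j+1} (k + 2 − j) = −c_j (k − j)` for `j < k`. [folklore] -/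
theorem cg_succ_mul {k j : ℕ} (hj : j < k) :
    cg k (j + 1) * ((k : ℂ) + 2 - j) = -(cg k j * ((k : ℂ) - j)) := by
  simp only [cg]
  rw [Finset.prod_range_succ, Finset.prod_eq_prod_Ico_succ_bot hj, pow_succ]
  ring

/-- `c_k = (−1)^k ∏_{t<k} (k − t) ≠ 0`. [folklore] -/
theorem cg_self_ne_zero (k : ℕ) : cg k k ≠ 0 := by
  simp only [cg, Finset.Ico_self, Finset.prod_empty, mul_one]
  refine mul_ne_zero (pow_ne_zero _ (by norm_num)) (Finset.prod_ne_zero_iff.2 fun t ht => ?_)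
  rw [Finset.mem_range] at ht
  rw [sub_ne_zero]
  exact_mod_cast (by omega : k ≠ t)

/-- **The vector `y`**: `y = ∑_{j ≤ k} c_j · (F_k^j w) ⊗ (F_k^{k−j} vTop)`, `k = 2d`, for a
`𝔨`-highest-weight vector `w ∈ C` of weight `k + 2` — the highest-weight vector of weight `2` of
`V_{k+2} ⊗ V_k ⊃ V_2`. [cite: Harder1987, §3.1 (3.1.3)] -/
def yVec (w : C) : model C d :=
  ∑ j ∈ range (2 * d + 1), cg (2 * d) j • tens d ((O.Fk ^ j) w) (((coeff (C := ℂ) d).Fk ^ (2 * d - j)) (vTop d))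

variable {O}

/-- **`H_k y = 2 y`** for the diagonal `𝔨` (each term has weight `(k+2−2j) + (k − 2(k−j)) = 2`).
[cite: Harder1987, §3.1] -/
theorem Hk_yVec (hO : O.IsLawful) {w : C} (hw : O.IsHW w ((2 * d + 2 : ℕ) : ℂ)) :
    ((aut O d).add (coeff (C := C) d)).Hk (yVec O d w) = (2 : ℂ) • yVec O d w := by
  have hHk : ∀ z : model C d, ((aut O d).add (coeff (C := C) d)).Hk z =
      (aut O d).Hk z + (coeff (C := C) d).Hk z := fun z => by
    simp only [Ops.Hk_apply, Ops.add_LH, Ops.add_RH]; abel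
  rw [hHk, yVec, map_sum, map_sum, Finset.smul_sum, ← Finset.sum_add_distrib]
  refine Finset.sum_congr rfl fun j hj => ?_
  rw [Finset.mem_range] at hj
  rw [map_smul, map_smul, (aut_k_tens d O _ _).2.2, (coeff_k_tens d _ _).2.2,
    Ops.Hk_Fk_pow hO hw.hk, Ops.Hk_Fk_pow (isLawful_coeff (C := ℂ) d) (coeff_Hk_vTop d),
    tens_smul_left, tens_smul, ← smul_add, ← add_smul, smul_smul, smul_smul]
  congr 1
  have : ((2 * d - j : ℕ) : ℂ) = 2 * d - j := by
    rw [Nat.cast_sub (by omega)]; push_cast; ring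
  rw [this]; push_cast; ring

/-- **`E_k y = 0`** for the diagonal `𝔨` (the recursion of the coefficients `c_j`).
[cite: Harder1987, §3.1] -/
theorem Ek_yVec (hO : O.IsLawful) {w : C} (hw : O.IsHW w ((2 * d + 2 : ℕ) : ℂ)) :
    ((aut O d).add (coeff (C := C) d)).Ek (yVec O d w) = 0 := by
  set k := 2 * d with hk
  have hEk : ∀ z : model C d, ((aut O d).add (coeff (C := C) d)).Ek z =
      (aut O d).Ek z + (coeff (C := C) d).Ek z := fun z => by
    simp only [Ops.Ek_apply, Ops.add_LE, Ops.add_RF]; abel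
  -- the two halves and the common tensors
  set A : ℕ → model C d := fun j =>
    tens d (O.Ek ((O.Fk ^ j) w)) (((coeff (C := ℂ) d).Fk ^ (k - j)) (vTop d)) with hA
  set B : ℕ → model C d := fun j =>
    tens d ((O.Fk ^ j) w) ((coeff (C := ℂ) d).Ek (((coeff (C := ℂ) d).Fk ^ (k - j)) (vTop d))) with hB
  set T : ℕ → model C d := fun j =>
    tens d ((O.Fk ^ j) w) (((coeff (C := ℂ) d).Fk ^ (k - j - 1)) (vTop d)) with hT
  have hsplit : ((aut O d).add (coeff (C := C) d)).Ek (yVec O d w) =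
      ∑ j ∈ range (k + 1), cg k j • A j + ∑ j ∈ range (k + 1), cg k j • B j := by
    rw [hEk, yVec, map_sum, map_sum, ← hk]
    congr 1 <;> refine Finset.sum_congr rfl fun j _ => ?_
    · rw [map_smul, (aut_k_tens d O _ _).1]
    · rw [map_smul, (coeff_k_tens d _ _).1]
  have hA0 : A 0 = 0 := by
    simp only [hA, pow_zero, Module.End.one_apply, hw.ek]
    apply Subtype.ext; funext l m; simp
  have hBk : B k = 0 := by
    simp only [hB, Nat.sub_self, pow_zero, Module.End.one_apply, coeff_Ek_vTop]
    apply Subtype.ext; funext l m; simp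
  have hA' : ∀ j, j < k → A (j + 1) = (((j : ℂ) + 1) * (((2 * d + 2 : ℕ) : ℂ) - j)) • T j := by
    intro j hj
    simp only [hA, hT]
    rw [Ops.Ek_Fk_pow_succ hO hw j, tens_smul_left, show k - (j + 1) = k - j - 1 by omega]
  have hB' : ∀ j, j < k → B j =
      ((((k - j - 1 : ℕ) : ℂ) + 1) * (((2 * d : ℕ) : ℂ) - ((k - j - 1 : ℕ) : ℂ))) • T j := by
    intro j hj
    simp only [hB, hT]
    rw [show k - j = (k - j - 1) + 1 by omega,
      Ops.Ek_Fk_pow_succ (isLawful_coeff (C := ℂ) d) (isHW_vTop d), tens_smul,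
      show k - j - 1 + 1 - 1 = k - j - 1 by omega]
  rw [hsplit, Finset.sum_range_succ' (fun j => cg k j • A j), hA0, smul_zero, add_zero,
    Finset.sum_range_succ (fun j => cg k j • B j), hBk, smul_zero, add_zero,
    ← Finset.sum_add_distrib]
  refine Finset.sum_eq_zero fun j hj => ?_
  rw [Finset.mem_range] at hj
  rw [hA' j hj, hB' j hj, smul_smul, smul_smul, ← add_smul]
  convert zero_smul ℂ (T j)
  have h := cg_succ_mul hj
  have e1 : ((k - j - 1 : ℕ) : ℂ) = (k : ℂ) - j - 1 := by
    rw [Nat.cast_sub (by omega), Nat.cast_sub (by omega)]; push_cast; ring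
  rw [e1]
  have e2 : ((2 * d + 2 : ℕ) : ℂ) = (k : ℂ) + 2 := by rw [hk]; push_cast; ring
  have e3 : ((2 * d : ℕ) : ℂ) = (k : ℂ) := by rw [hk]
  rw [e2, e3]
  linear_combination ((j : ℂ) + 1) * h

end Y

/-! ### `𝔨`-finiteness of the model and `F_k³ y = 0`, `y ≠ 0` -/

section Finite

variable (O : Ops C) (d : ℕ)

/-- The arrays with all entries in a subspace `S ≤ C`. [folklore] -/
def valuesIn (S : Submodule ℂ C) : Submodule ℂ (model C d) where
  carrier := {u | ∀ l m, (u : ℕ → ℕ → C) l m ∈ S}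
  zero_mem' := fun _ _ => S.zero_mem
  add_mem' hu hv l m := S.add_mem (hu l m) (hv l m)
  smul_mem' c _ hu l m := S.smul_mem c (hu l m)

/-- Membership. [folklore] -/
theorem mem_valuesIn {S : Submodule ℂ C} {u : model C d} :
    u ∈ valuesIn d S ↔ ∀ l m, (u : ℕ → ℕ → C) l m ∈ S := Iff.rfl

/-- **Arrays with values in a finite-dimensional subspace form a finite-dimensional space** (they
embed into `Fin (d+1)² → S`). [folklore] -/
theorem finiteDimensional_valuesIn (S : Submodule ℂ C) [FiniteDimensional ℂ S] :
    FiniteDimensional ℂ (valuesIn (C := C) d S) := by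
  let Φ : valuesIn (C := C) d S →ₗ[ℂ] (Fin (d + 1) × Fin (d + 1) → S) :=
    { toFun := fun u p => ⟨((u : model C d) : ℕ → ℕ → C) p.1 p.2, u.2 p.1 p.2⟩
      map_add' := fun _ _ => funext fun _ => rfl
      map_smul' := fun _ _ => funext fun _ => rfl }
  refine Module.Finite.of_injective Φ fun u v huv => ?_
  apply Subtype.ext; apply Subtype.ext; funext l m
  by_cases hl : d < l
  · rw [(u : model C d).2 l m (Or.inl hl), (v : model C d).2 l m (Or.inl hl)]
  by_cases hm : d < m
  · rw [(u : model C d).2 l m (Or.inr hm), (v : model C d).2 l m (Or.inr hm)]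
  have := congrArg (fun F : Fin (d + 1) × Fin (d + 1) → S => (F (⟨l, by omega⟩, ⟨m, by omega⟩) : C)) huv
  exact this

/-- The diagonal `𝔨`-operators of the model preserve `valuesIn S` for `S` stable under
`E_k, F_k, H_k` of `C`. [folklore] -/
theorem valuesIn_stable {S : Submodule ℂ C} (hES : ∀ x ∈ S, O.Ek x ∈ S)
    (hFS : ∀ x ∈ S, O.Fk x ∈ S) (hHS : ∀ x ∈ S, O.Hk x ∈ S) :
    (∀ u ∈ valuesIn d S, ((aut O d).add (coeff (C := C) d)).Ek u ∈ valuesIn d S) ∧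
    (∀ u ∈ valuesIn d S, ((aut O d).add (coeff (C := C) d)).Fk u ∈ valuesIn d S) ∧
    (∀ u ∈ valuesIn d S, ((aut O d).add (coeff (C := C) d)).Hk u ∈ valuesIn d S) := by
  refine ⟨fun u hu l m => ?_, fun u hu l m => ?_, fun u hu l m => ?_⟩
  · have e : (((aut O d).add (coeff (C := C) d)).Ek u : ℕ → ℕ → C) l m =
        O.Ek ((u : ℕ → ℕ → C) l m) + (sE d (u : ℕ → ℕ → C) l m - sF ((u : ℕ → ℕ → C) l) m) := by
      simp only [Ops.Ek_apply, Ops.add_LE, Ops.add_RF, Submodule.coe_sub, Submodule.coe_add,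
        Pi.add_apply, Pi.sub_apply, aut, coeff, Ops.restrict_LE, Ops.restrict_RF, opsAut_LE,
        opsAut_RF, opsCoeff_LE, opsCoeff_RF]
      abel
    rw [e]
    refine S.add_mem (hES _ (hu l m)) (S.sub_mem ?_ ?_)
    · rcases l with _ | l
      · simp
      · rw [sE_apply_succ]; exact S.smul_mem _ (hu l m)
    · rw [sF_apply]; exact S.smul_mem _ (hu l (m + 1))
  · have e : (((aut O d).add (coeff (C := C) d)).Fk u : ℕ → ℕ → C) l m =
        O.Fk ((u : ℕ → ℕ → C) l m) + (sF (u : ℕ → ℕ → C) l m - sE d ((u : ℕ → ℕ → C) l) m) := by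
      simp only [Ops.Fk_apply, Ops.add_LF, Ops.add_RE, Submodule.coe_sub, Submodule.coe_add,
        Pi.add_apply, Pi.sub_apply, aut, coeff, Ops.restrict_LF, Ops.restrict_RE, opsAut_LF,
        opsAut_RE, opsCoeff_LF, opsCoeff_RE]
      abel
    rw [e]
    refine S.add_mem (hFS _ (hu l m)) (S.sub_mem ?_ ?_)
    · rw [sF_apply]; exact S.smul_mem _ (hu (l + 1) m)
    · rcases m with _ | m
      · simp
      · rw [sE_apply_succ]; exact S.smul_mem _ (hu l m)
  · have e : (((aut O d).add (coeff (C := C) d)).Hk u : ℕ → ℕ → C) l m =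
        O.Hk ((u : ℕ → ℕ → C) l m) + (sH d (u : ℕ → ℕ → C) l m - sH d ((u : ℕ → ℕ → C) l) m) := by
      simp only [Ops.Hk_apply, Ops.add_LH, Ops.add_RH, Submodule.coe_sub, Submodule.coe_add,
        Pi.add_apply, Pi.sub_apply, aut, coeff, Ops.restrict_LH, Ops.restrict_RH, opsAut_LH,
        opsAut_RH, opsCoeff_LH, opsCoeff_RH]
      abel
    rw [e]
    refine S.add_mem (hHS _ (hu l m)) (S.sub_mem ?_ ?_)
    · rw [sH_apply]; exact S.smul_mem _ (hu l m)
    · rw [sH_apply]; exact S.smul_mem _ (hu l m)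

/-- `y` has values in any `F_k`-stable subspace containing `w`. [folklore] -/
theorem yVec_mem_valuesIn {S : Submodule ℂ C} (hFS : ∀ x ∈ S, O.Fk x ∈ S) {w : C} (hw : w ∈ S) :
    yVec O d w ∈ valuesIn d S := by
  intro l m
  rw [yVec]
  simp only [AddSubmonoidClass.coe_finsetSum, SetLike.val_smul, Finset.sum_apply, Pi.smul_apply,
    tens_apply]
  exact S.sum_mem fun j _ => S.smul_mem _ (S.smul_mem _ (Ops.Fk_pow_mem hFS hw j))

variable {O}

/-- **`F_k³ y = 0`** for the diagonal `𝔨`, when `w` lies in a finite-dimensional `𝔨`-stable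
subspace of `C` (`y` is a highest-weight vector of weight `2` in the finite-dimensional stable
subspace of arrays with values there). [cite: Harder1987, §3.1] -/
theorem Fk_pow_three_yVec (hO : O.IsLawful) {S : Submodule ℂ C} [FiniteDimensional ℂ S]
    (hES : ∀ x ∈ S, O.Ek x ∈ S) (hFS : ∀ x ∈ S, O.Fk x ∈ S) (hHS : ∀ x ∈ S, O.Hk x ∈ S)
    {w : C} (hwS : w ∈ S) (hw : O.IsHW w ((2 * d + 2 : ℕ) : ℂ)) :
    (((aut O d).add (coeff (C := C) d)).Fk ^ 3) (yVec O d w) = 0 := by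
  haveI := finiteDimensional_valuesIn (C := C) d S
  obtain ⟨h1, h2, h3⟩ := valuesIn_stable O d hES hFS hHS
  have hOH := Ops.isLawful_add (isLawful_aut d hO) (isLawful_coeff (C := C) d)
    (commutesWith_aut_coeff d)
  have hHW : ((aut O d).add (coeff (C := C) d)).IsHW (yVec O d w) ((2 : ℕ) : ℂ) :=
    ⟨Ek_yVec d hO hw, by rw [Nat.cast_ofNat]; exact Hk_yVec d hO hw⟩
  exact Ops.Fk_pow_succ_eq_zero hOH h1 h2 h3 (yVec_mem_valuesIn O d hFS hwS) hHW

/-- **The entry `(d, 0)` of `y` is `c_k F_k^k w`** (all lowered top vectors vanish there).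
[folklore] -/
theorem yVec_apply_top (w : C) :
    ((yVec O d w : model C d) : ℕ → ℕ → C) d 0 = cg (2 * d) (2 * d) • (O.Fk ^ (2 * d)) w := by
  rw [yVec]
  simp only [AddSubmonoidClass.coe_finsetSum, SetLike.val_smul, Finset.sum_apply, Pi.smul_apply,
    tens_apply]
  rw [Finset.sum_range_succ, Finset.sum_eq_zero fun j hj => ?_, zero_add, Nat.sub_self, pow_zero,
    Module.End.one_apply, vTop_apply_top, one_smul]
  rw [Finset.mem_range] at hj
  rw [show 2 * d - j = (2 * d - j - 1) + 1 by omega, Fk_pow_succ_vTop_apply_top, zero_smul, smul_zero]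

/-- **`y ≠ 0`** when `w ≠ 0` lies in a `𝔨`-stable subspace (then `F_k^k w ≠ 0`, `k ≤ k + 2`).
[cite: Harder1987, §3.1] -/
theorem yVec_ne_zero (hO : O.IsLawful) {S : Submodule ℂ C}
    (hES : ∀ x ∈ S, O.Ek x ∈ S) (hFS : ∀ x ∈ S, O.Fk x ∈ S) (hHS : ∀ x ∈ S, O.Hk x ∈ S)
    {w : C} (hwS : w ∈ S) (hw0 : w ≠ 0) (hw : O.IsHW w ((2 * d + 2 : ℕ) : ℂ)) : yVec O d w ≠ 0 := by
  intro h0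
  have h1 := congrArg (fun z : model C d => (z : ℕ → ℕ → C) d 0) h0
  simp only [yVec_apply_top, ZeroMemClass.coe_zero, Pi.zero_apply, smul_eq_zero] at h1
  rcases h1 with h1 | h1
  · exact cg_self_ne_zero _ h1
  · exact Ops.Fk_pow_ne_zero hO hES hFS hHS hwS hw0 hw (by omega) h1

/-- **The cochain is non-zero**: `η 0 = −F_k y ≠ 0` (else `0 = E_k F_k y = 2y`). [folklore] -/
theorem eshCochain_yVec_ne_zero (hO : O.IsLawful) {S : Submodule ℂ C}
    (hES : ∀ x ∈ S, O.Ek x ∈ S) (hFS : ∀ x ∈ S, O.Fk x ∈ S) (hHS : ∀ x ∈ S, O.Hk x ∈ S)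
    {w : C} (hwS : w ∈ S) (hw0 : w ≠ 0) (hw : O.IsHW w ((2 * d + 2 : ℕ) : ℂ)) :
    eshCochain ((aut O d).add (coeff (C := C) d)) (yVec O d w) 0 ≠ 0 := by
  rw [eshCochain_zero, neg_ne_zero]
  intro hF
  have hOH := Ops.isLawful_add (isLawful_aut d hO) (isLawful_coeff (C := C) d)
    (commutesWith_aut_coeff d)
  obtain ⟨s1, -, -, -⟩ := string_identities hOH (Ek_yVec d hO hw) (Hk_yVec d hO hw)
  rw [hF, map_zero] at s1
  exact yVec_ne_zero d hO hES hFS hHS hwS hw0 hw ((smul_eq_zero.1 s1.symm).resolve_left two_ne_zero)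

end Finite

/-! ### The positive form of the model and the adjointness relations -/

section Form

variable (d : ℕ) {ip : C → C → ℂ} (hip : Kuga.IsPosForm ip)

variable (ip) in
/-- **The form of the model**: `⟪u, v⟫ = ∑_{l,m ≤ d} g_l g_m ⟪u_{lm}, v_{lm}⟫` with the admissible
weights `g_l = l!(d−l)!` on both tensor factors. [cite: BorelWallach2000, II §2.2] -/
def ipModel (u v : model C d) : ℂ :=
  ∑ l ∈ range (d + 1), ∑ m ∈ range (d + 1),
    wt d l * wt d m * ip ((u : ℕ → ℕ → C) l m) ((v : ℕ → ℕ → C) l m)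

/-- `g_l` is the cast of a positive natural number. [folklore] -/
theorem wt_pos_nat (l : ℕ) : ∃ n : ℕ, 0 < n ∧ wt d l = n :=
  ⟨l.factorial * (d - l).factorial, Nat.mul_pos (Nat.factorial_pos _) (Nat.factorial_pos _), rfl⟩

include hip

/-- **The form of the model is a positive definite Hermitian form.** [folklore] -/
theorem isPosForm_ipModel : Kuga.IsPosForm (ipModel (C := C) d ip) where
  add_left x y z := by
    simp only [ipModel, Submodule.coe_add, Pi.add_apply, hip.add_left, mul_add, Finset.sum_add_distrib]
  smul_left c x y := by
    simp only [ipModel, SetLike.val_smul, Pi.smul_apply, hip.smul_left, Finset.mul_sum]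
    refine Finset.sum_congr rfl fun l _ => Finset.sum_congr rfl fun m _ => ?_
    ring
  conj_symm x y := by
    simp only [ipModel, map_sum, map_mul]
    refine Finset.sum_congr rfl fun l _ => Finset.sum_congr rfl fun m _ => ?_
    obtain ⟨a, -, ha⟩ := wt_pos_nat d l
    obtain ⟨b, -, hb⟩ := wt_pos_nat d m
    rw [hip.conj_symm, ha, hb, Complex.conj_natCast, Complex.conj_natCast]
  nonneg x := by
    simp only [ipModel, Complex.re_sum]
    refine Finset.sum_nonneg fun l _ => Finset.sum_nonneg fun m _ => ?_
    obtain ⟨a, -, ha⟩ := wt_pos_nat d l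
    obtain ⟨b, -, hb⟩ := wt_pos_nat d m
    rw [ha, hb, ← Nat.cast_mul, ← Complex.ofReal_natCast, Complex.re_ofReal_mul]
    exact mul_nonneg (Nat.cast_nonneg _) (hip.nonneg _)
  definite x hx := by
    have hre := congrArg Complex.re hx
    simp only [ipModel, Complex.re_sum, Complex.zero_re] at hre
    have hterm : ∀ l ∈ range (d + 1), ∀ m ∈ range (d + 1),
        0 ≤ (wt d l * wt d m * ip ((x : ℕ → ℕ → C) l m) ((x : ℕ → ℕ → C) l m)).re := by
      intro l _ m _
      obtain ⟨a, -, ha⟩ := wt_pos_nat d l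
      obtain ⟨b, -, hb⟩ := wt_pos_nat d m
      rw [ha, hb, ← Nat.cast_mul, ← Complex.ofReal_natCast, Complex.re_ofReal_mul]
      exact mul_nonneg (Nat.cast_nonneg _) (hip.nonneg _)
    have hrow := (Finset.sum_eq_zero_iff_of_nonneg fun l hl => Finset.sum_nonneg (hterm l hl)).1 hre
    apply Subtype.ext; funext l m
    by_cases hl : d < l
    · exact x.2 l m (Or.inl hl)
    by_cases hm : d < m
    · exact x.2 l m (Or.inr hm)
    have hl' : l ∈ range (d + 1) := Finset.mem_range.2 (by omega)
    have hm' : m ∈ range (d + 1) := Finset.mem_range.2 (by omega)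
    have h1 := (Finset.sum_eq_zero_iff_of_nonneg (hterm l hl')).1 (hrow l hl') m hm'
    obtain ⟨a, ha0, ha⟩ := wt_pos_nat d l
    obtain ⟨b, hb0, hb⟩ := wt_pos_nat d m
    rw [ha, hb, ← Nat.cast_mul, ← Complex.ofReal_natCast, Complex.re_ofReal_mul] at h1
    have hab : (0 : ℝ) < (a * b : ℕ) := by exact_mod_cast Nat.mul_pos ha0 hb0
    exact hip.eq_zero_of_re_self_eq_zero ((mul_eq_zero.1 h1).resolve_left hab.ne')

variable {O : Ops C}

omit hip in
/-- **The automorphic family is of unitary type for the form of the model** when `O` is for `ip`: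
`⟪L₁(E) u, v⟫ = −⟪u, R₁(E) v⟫`, same for `F`, `H`. [cite: Harder1987, §3.1] -/
theorem aut_adjoint (hE : ∀ x y, ip (O.LE x) y = -ip x (O.RE y))
    (hF : ∀ x y, ip (O.LF x) y = -ip x (O.RF y)) (hH : ∀ x y, ip (O.LH x) y = -ip x (O.RH y)) :
    (∀ u v, ipModel d ip ((aut O d).LE u) v = -ipModel d ip u ((aut O d).RE v)) ∧
    (∀ u v, ipModel d ip ((aut O d).LF u) v = -ipModel d ip u ((aut O d).RF v)) ∧
    (∀ u v, ipModel d ip ((aut O d).LH u) v = -ipModel d ip u ((aut O d).RH v)) := by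
  refine ⟨fun u v => ?_, fun u v => ?_, fun u v => ?_⟩ <;>
  simp only [ipModel, aut, Ops.restrict_LE, Ops.restrict_RE, Ops.restrict_LF, Ops.restrict_RF,
    Ops.restrict_LH, Ops.restrict_RH, opsAut_LE, opsAut_RE, opsAut_LF, opsAut_RF, opsAut_LH,
    opsAut_RH, hE, hF, hH, mul_neg, Finset.sum_neg_distrib]

omit hip in
/-- A column of a member of the model (fixed inner index) has support `≤ d`. [folklore] -/
theorem col_mem_supp {u : ℕ → ℕ → C} (hu : u ∈ model C d) (m : ℕ) : (fun l => u l m) ∈ supp C d :=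
  fun l hl => hu l m (Or.inl hl)

omit hip in
/-- The outer operators read on a column. [folklore] -/
theorem outer_col (u : ℕ → ℕ → C) (m : ℕ) :
    (∀ l, sE d (α := ℕ → C) u l m = sE d (fun l => u l m) l) ∧
    (∀ l, sF (α := ℕ → C) u l m = sF (fun l => u l m) l) ∧
    (∀ l, sH d (α := ℕ → C) u l m = sH d (fun l => u l m) l) := by
  refine ⟨fun l => ?_, fun l => ?_, fun l => ?_⟩
  · rcases l with _ | l <;> simp
  · simp
  · simp

/-- **The coefficient family is of compact type for the form of the model**:
`⟪L₂(E) u, v⟫ = ⟪u, L₂(F) v⟫`, `⟪L₂(H) u, v⟫ = ⟪u, L₂(H) v⟫`, and the same for `R₂` — the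
admissible inner product (`E† = F`, `H† = H` factorwise). [cite: BorelWallach2000, II §2.2] -/
theorem coeff_adjoint :
    (∀ u v, ipModel d ip ((coeff (C := C) d).LE u) v = ipModel d ip u ((coeff (C := C) d).LF v)) ∧
    (∀ u v, ipModel d ip ((coeff (C := C) d).LH u) v = ipModel d ip u ((coeff (C := C) d).LH v)) ∧
    (∀ u v, ipModel d ip ((coeff (C := C) d).RE u) v = ipModel d ip u ((coeff (C := C) d).RF v)) ∧
    (∀ u v, ipModel d ip ((coeff (C := C) d).RH u) v = ipModel d ip u ((coeff (C := C) d).RH v)) := by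
  have hl := hip.smul_left
  have hr := hip.smul_right
  have h0 := hip.zero_left
  have h0' := hip.zero_right
  refine ⟨fun u v => ?_, fun u v => ?_, fun u v => ?_, fun u v => ?_⟩
  · -- outer `E† = F`: swap the sums and work column by column
    simp only [ipModel, coeff, Ops.restrict_LE, Ops.restrict_LF, opsCoeff_LE, opsCoeff_LF]
    rw [Finset.sum_comm, Finset.sum_comm (s := range (d + 1)) (t := range (d + 1))
      (f := fun l m => wt d l * wt d m * ip ((u : ℕ → ℕ → C) l m) (sF (α := ℕ → C) (v : ℕ → ℕ → C) l m))]
    refine Finset.sum_congr rfl fun m _ => ?_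
    have key := sum_sE_eq_sum_sF (d := d) hl hr h0 h0' (fun l => (u : ℕ → ℕ → C) l m)
      (col_mem_supp d v.2 m)
    simp only [(outer_col d (u : ℕ → ℕ → C) m).1, (outer_col d (v : ℕ → ℕ → C) m).2.1]
    calc ∑ l ∈ range (d + 1), wt d l * wt d m * ip (sE d (fun l => (u : ℕ → ℕ → C) l m) l) ((v : ℕ → ℕ → C) l m)
        = wt d m * ∑ l ∈ range (d + 1), wt d l * ip (sE d (fun l => (u : ℕ → ℕ → C) l m) l) ((v : ℕ → ℕ → C) l m) := by
          rw [Finset.mul_sum]; refine Finset.sum_congr rfl fun l _ => ?_; ring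
      _ = wt d m * ∑ l ∈ range (d + 1), wt d l * ip ((u : ℕ → ℕ → C) l m) (sF (fun l => (v : ℕ → ℕ → C) l m) l) := by
          rw [key]
      _ = _ := by rw [Finset.mul_sum]; refine Finset.sum_congr rfl fun l _ => ?_; ring
  · simp only [ipModel, coeff, Ops.restrict_LH, opsCoeff_LH]
    refine Finset.sum_congr rfl fun l _ => Finset.sum_congr rfl fun m _ => ?_
    simp only [(outer_col d (u : ℕ → ℕ → C) m).2.2, (outer_col d (v : ℕ → ℕ → C) m).2.2, sH_apply,
      hl, hr, map_sub, map_natCast]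
  · -- inner `E† = F`, row by row
    simp only [ipModel, coeff, Ops.restrict_RE, Ops.restrict_RF, opsCoeff_RE, opsCoeff_RF]
    refine Finset.sum_congr rfl fun l _ => ?_
    have key := sum_sE_eq_sum_sF (d := d) hl hr h0 h0' ((u : ℕ → ℕ → C) l) (row_mem_supp v.2 l)
    calc ∑ m ∈ range (d + 1), wt d l * wt d m * ip (sE d ((u : ℕ → ℕ → C) l) m) ((v : ℕ → ℕ → C) l m)
        = wt d l * ∑ m ∈ range (d + 1), wt d m * ip (sE d ((u : ℕ → ℕ → C) l) m) ((v : ℕ → ℕ → C) l m) := by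
          rw [Finset.mul_sum]; refine Finset.sum_congr rfl fun m _ => ?_; ring
      _ = wt d l * ∑ m ∈ range (d + 1), wt d m * ip ((u : ℕ → ℕ → C) l m) (sF ((v : ℕ → ℕ → C) l) m) := by
          rw [key]
      _ = _ := by rw [Finset.mul_sum]; refine Finset.sum_congr rfl fun m _ => ?_; ring
  · simp only [ipModel, coeff, Ops.restrict_RH, opsCoeff_RH]
    refine Finset.sum_congr rfl fun l _ => Finset.sum_congr rfl fun m _ => ?_
    simp only [sH_apply, hl, hr, map_sub, map_natCast]

end Form

/-! ### Assembly: the closed, co-closed, non-zero Eichler–Shimura–Harder cochain of the model -/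

section Main

variable {O : Ops C} (d : ℕ) {ip : C → C → ℂ}

/-- **The Eichler–Shimura–Harder cochain of the model.**  Let `C` carry six lawful operators `O`
with `Ω_L = Ω_R = ½ d(d+2)` (the infinitesimal character of `Sym^d ⊗ \overline{Sym^d}`), a positive
form for which `O` is of unitary type, and let `w ≠ 0` be a `𝔨`-highest-weight vector of weight
`2d + 2` lying in a finite-dimensional `𝔨`-stable subspace.  Then on the model
`H = C ⊗ Sym^d ⊗ \overline{Sym^d}` (families `aut O d`, `coeff d`) the cochain
`η = eshCochain (aut + coeff) y` of the weight-`2` vector `y = yVec O d w` is a NON-ZERO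
`1`-cochain of Kuga's relative complex which is CLOSED and CO-CLOSED:
`D_i η_j = D_j η_i`, `δη = 0`. [cite: Harder1987, §3.1 (3.1.3)–(3.1.5)]
[cite: BorelWallach2000, II Prop. 2.5] [cite: MatsushimaMurakami1963, §6] -/
theorem eshCochain_model (hO : O.IsLawful)
    (hcL : ∀ x, O.casL x = ((2 : ℂ)⁻¹ * (d * (d + 2))) • x)
    (hcR : ∀ x, O.casR x = ((2 : ℂ)⁻¹ * (d * (d + 2))) • x)
    (hip : Kuga.IsPosForm ip) (hE : ∀ x y, ip (O.LE x) y = -ip x (O.RE y))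
    (hF : ∀ x y, ip (O.LF x) y = -ip x (O.RF y)) (hH : ∀ x y, ip (O.LH x) y = -ip x (O.RH y))
    {S : Submodule ℂ C} [FiniteDimensional ℂ S]
    (hES : ∀ x ∈ S, O.Ek x ∈ S) (hFS : ∀ x ∈ S, O.Fk x ∈ S) (hHS : ∀ x ∈ S, O.Hk x ∈ S)
    {w : C} (hwS : w ∈ S) (hw0 : w ≠ 0) (hw : O.IsHW w ((2 * d + 2 : ℕ) : ℂ)) :
    let η := eshCochain ((aut O d).add (coeff (C := C) d)) (yVec O d w)
    η 0 ≠ 0 ∧ (setup (aut O d) (coeff (C := C) d)).IsCochain η ∧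
    (∀ i j, (setup (aut O d) (coeff (C := C) d)).D i (η j) = (setup (aut O d) (coeff (C := C) d)).D j (η i)) ∧
    (setup (aut O d) (coeff (C := C) d)).deltaOne η = 0 := by
  intro η
  have h₁ := isLawful_aut d hO
  have h₂ := isLawful_coeff (C := C) d
  have hc := commutesWith_aut_coeff (O := O) d
  have hOH := Ops.isLawful_add h₁ h₂ hc
  have hcas : ∀ v, (aut O d).casL v + (aut O d).casR v =
      (coeff (C := C) d).casL v + (coeff (C := C) d).casR v := fun v => by
    rw [casL_aut d hcL, casR_aut d hcR, casL_coeff, casR_coeff]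
  have hEy := Ek_yVec d hO hw
  have hHy := Hk_yVec d hO hw
  have hF3 : ((aut O d).add (coeff (C := C) d)).Fk (((aut O d).add (coeff (C := C) d)).Fk
      (((aut O d).add (coeff (C := C) d)).Fk (yVec O d w))) = 0 := by
    have := Fk_pow_three_yVec d hO hES hFS hHS hwS hw
    simpa [pow_succ, Module.End.mul_apply] using this
  obtain ⟨hE₁, hF₁, hH₁⟩ := aut_adjoint d hE hF hH
  obtain ⟨hLE₂, hLH₂, hRE₂, hRH₂⟩ := coeff_adjoint (C := C) d hip
  obtain ⟨hclosed, hcoclosed⟩ := eshCochain_closed_coclosed h₁ h₂ hc hcas (isPosForm_ipModel d hip)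
    hE₁ hF₁ hH₁ hLE₂ hLH₂ hRE₂ hRH₂ hEy hHy hF3
  exact ⟨eshCochain_yVec_ne_zero d hO hES hFS hHS hwS hw0 hw, isCochain_eshCochain hOH rfl hEy hHy hF3,
    hclosed, hcoclosed⟩

end Main

end GL2CESH

end Literature.NumberTheory.Automorphic

end
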